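import Summits.Ventures.HSemireg.Pad4TowerRuleDMu4

/-!
# Venture HSemireg — PAD-4: LEMMA A∪2I′ (PAD4-BALANCED §17) on 𝔅(μ₄), CLEAN SUFFICIENT FORM with `W = ∅` over an apex factor, as
# finite kill predicates — the LINE form (one confining direction) and the ZERO form (two confining directions)

HONEST FRAMING. Lean index of the computation cell `pub-hsemireg` (S4-PUSH, H2 door PAD-4), typed by the Ventures-side typer
`hodge-lit-semireg-typer-2` (g2); companion of `Pad4TowerRuleDMu4` (μ₄ RULE D) answering the second half of the consumer's «μ₄
lift = typing (μ₄ RULE D + μ₄ kills on MCell)» (`W2-KERNEL-RUNGS-assembly-p1-g0.md`; typer-2 g0 close, follow-up (a) «μ₄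
clean-form A∪2I′ predicate»). The (F1ℝ) file `Pad4TowerLemmaA2I` (p539482) types §17's CLEAN SUFFICIENT FORM on the paired-axes
slice (`A2IDead`, per entry, `|W| ≤ 1`); `Pad4TowerCrossPhase` ∕ `Pad4TowerXPhaseMu4Unit` type LEMMA X-PHASE on 𝔅(μ₄). THIS FILE
types §17's clean sufficient form ON 𝔅(μ₄) in the case that carries the cell's census kills — the demand factor `f″` an APEX
point (`β = 0`: an `O`-factor, a bare node) NOT served below at `Z` in any direction (`W_{f″}(Z) = ∅`) — in two support-checkable
instances of the state recursion: **`A2IDeadMu4Line`** (the partner directions on `σ` lie in one frame `{u, −u}` — automatic for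
a charged μ₄ letter among μ₄ cells — and every present `u`-partner, at every depth, has an UNPOLLUTED `f″`-server in ONE common
direction `v`: states `A_u(d) ⊆ Ξ_v`) and **`A2IDeadMu4Zero`** (every present partner of `Z` on `σ`, in every direction, has
unpolluted `f″`-servers in TWO DISTINCT directions: all states `0` — LEMMA 2I of §15, the uncharged-node instance).

TEXT OF RECORD (PAD4-BALANCED-search-1.md v2.9 93790c5bf8784622 §17, statement of record v1.1 after s4-ref-2 g8's ×2 743ff03f31655d32
∕ e036450b1c974e99). SETTING: «𝔅(μ₄) …, a finite RULE-D configuration, mode I, classes; Z an N-constituent; σ a factor and u a null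
direction on σ with u-PARTNERS P^{(d)} = Z − d·n_u^{(σ)} ∈ E₊ …; f′ ≠ σ a factor and W := W_{f′}(Z) = the set of null directions
w on f′ such that some P-constituent P′ ≤ Z has (Z − P′)_{f′} ∈ ℕ_{≥1}·n_w (legs of Z on f′ AND (r2a)-type partners with a null
f′-part)». ROW CENSUS of an `f′`-server `N′ = P^{(d)} + e·n_v^{(f′)} ∈ E₋`: «the set of P′ ∈ E₊, P′ ≠ P^{(d)}, P′ ≤ N′, with (C1)
P′_g = Z_g for both g ∉ {σ, f′}; (C2) P′_σ = Z_σ − (d + e′)·n_u for some e′ ≥ 0; (C3) z := P′_{f′} − Z_{f′} satisfies «e·n_v − z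
is future-causal or 0» and z ∈ {0} ∪ {null} ∪ {spacelike}», species (3a) deeper partners (z = 0), (3b) null-lifted siblings, (3c)
below-on-f′ (w ∈ W), (3d) spacelike-lifted; states «A(d) ⊆ V_{f′} := ⋂ Ξ_v over those N′ ∈ 𝒮(d) whose census contains NO alive
member other than deeper partners P^{(d″)} with A(d″) ⊆ Ξ_v (A(d) := V_{f′} for an empty intersection; two unpolluted directions
give 0)»; LEMMA A∪2I′: «Z violates (E1) if D(Z) ⊄ Σ_{w ∈ Dir_σ(Z)} Ξ_w ⊗ A_w + V_σ ⊗ Σ_{w′ ∈ W} Ξ_{w′}» (D(Z) = the demanded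
`(V_σ ⊗ V_{f′})`-component, PAIR-IMAGE THEOREM: entry `(r,r′)` non-zero iff `c_r(x_σ) ≠ c_{r′}(x_{f′})`; O1: at an apex σ-point
four served directions with line states CAN feed everything); CLEAN SUFFICIENT FORM: «if no census member of species (3b), (3c),
(3d) EXISTS in E₊ for any server of any u-partner, the states are computed from the u-partners alone, and the conclusion holds as
stated. INSTANCES: W = ∅ is LEMMA 2I (§15: the whole V_{f′} must be spanned)».

WHY THESE TWO INSTANCES ARE INSTANCES (the reading the predicates encode; pencil, for the referee). `f″` apex and `W = ∅`: the feed
is `Σ_w Ξ_w ⊗ A_w`. LINE form: partner directions `⊆ {u, −u}`, `A_u ⊆ Ξ_v` (one common clean direction `v` at every depth, so a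
deeper partner, confined to `Ξ_v`, never pollutes a `v`-server — the same device as `Pad4TowerLemmaA2I.A2IDead`), `A_{−u}` arbitrary
`⊆ V`: feed `⊆ Ξ_u ⊗ Ξ_v + Ξ_{−u} ⊗ V`, which misses the row-`u` part `ξ̄_u ⊗ (D·ξ̄_{r′} − D·ξ̄_{−r′}) = 2D r̄′·ξ̄_u ⊗ ē_B` of
`M_{f″σ}` (`D = c_u(x_σ) − α(x_{f″})∕2 ≠ 0` = DEMANDED; `ē_B` is not a null covector) — so `D(Z) ⊄` feed. ZERO form: all `A_w = 0`,
feed `= 0`, dead iff demanded. Both are the text's recursion evaluated on supports where it is decided by presence∕absence alone.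

CONVENTIONS. Cells, configurations, `UPartner`, `ray`, `Effective`, `bsub` from `Pad4TowerCrossPhase`; `coord`, `Adapted`,
`isApex`, `MServedBelow`, `MCoverBelow` from `Pad4TowerRuleDMu4`. Directions `k : Fin 4` ↔ phases `i^k` ↔ `step k = n_{i^k}`.
`W_{f″}(Z) ∋ w` is `MServedDirBelow` (a leg, or the null `f″`-part of an (r2a) cover). A POLLUTER of the server `N′` of the
`u`-partner `P` is a `P′ ∈ E₊` with (C1), (C2) (on `Z`'s `u`-line at depth `≥` that of `P`), and (C3) with `z ≠ 0`, `P′_{f″} ≤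
N′_{f″}` causally, `z` NOT timelike (`|Δβ|² ≥ Δα²`) — i.e. species (3b) ∪ (3c) ∪ (3d); under `W = ∅` no (3c) member exists (it
would be an (r2a) partner of `Z` with a null `f″`-part), so forbidding all three is forbidding (3b), (3d) — the CLEAN form verbatim.
Entries («mode I, non-zero leg entries») are not carried by `MConfig`, as in every `Pad4Tower*` file.

CONTENT. §1 `Timelike`, `MServedDirBelow`, `PolluterMu4`, `CleanServerMu4`; §2 **`A2IDeadMu4Line C Z σ u f″ v`**, **`A2IDeadMu4Zero
C Z σ f″`**; §3 kernel probes (`decide`) on the D_ML8 pattern of §13∕§15: `Z = [O|ℓ₁|ℓ_i|2I]` with its `ℓ₁`-cancellation and that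
cancellation's four `O`-servers `[ℓ_v|O|ℓ_i|2I]` is LINE-dead (σ = the `ℓ₁` factor, f″ = the `O` factor, any `v`) and ZERO-dead;
adding the null-lifted sibling `P′ = [ℓ₁|O|ℓ_i|2I]` (species (3b)) kills the `v = 0` server's cleanness — LINE-dead only through
`v ≠ 0`, and no longer ZERO-dead once two lifted siblings are present. OFFLINE CENSUS (this typer, `staging/…/g2/xcheck/
a2i_mu4_mirror.py`): over the full support D_ML8 = ML8^G (`kitds/D_ML8.json` 1b196cbe56773418, 326 N + 304 P) the LINE form kills
exactly the 192 `[O|ℓ|ℓ|2I]`, the ZERO form exactly those and the 6 `[O|O|2I|2I]`, and neither touches the 128 `[ℓℓℓℓ]` — class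
for class leak9's E₋ verdict on D_ML8 (kit j269985, `result-j269985-DML8-leak9.json`: killed `Nl2` 192 + `N22` 6 = 198 ∕ 326,
undecided `N4` 128; PAD4-BALANCED §13).

WHAT IS NOT HERE ∕ NOT IN LEAN. The (E1)-meaning (§17's PROOF: demand (S3), pins, the least-fixpoint recursion; ×2 s4-ref-2 g8) —
pencil, cited; «dead» means «satisfies the predicate». Not typed: `|W| = 1` and charged `f″` (the (F1ℝ) `A2IDead` has them on the
slice; on 𝔅(μ₄) the demanded row is then a single entry whose feeding by an orthogonal line state is not a presence question), apex
`σ` with line states (O1), in-pencil (3c) non-polluters, the `P`-side duals, multiplicities, sections. No bridge lemma to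
`Pad4TowerLemmaA2I.A2IDead` is claimed (the slice restriction of the LINE form implies it; not proved here). Nothing is a statement
about a variety, a sheaf, `σ`, a seed or an abelian variety; NOTHING HERE SAYS THAT HC ∕ HC_CM ∕ HC_AV ∕ W₆ ∕ HC_Kum4Type HOLDS OR
FAILS. No `instance`, no notation, no named fact, 0 `sorry`; axioms standard.

SOURCES (sha16): PAD4-BALANCED-search-1.md v2.9 93790c5bf8784622 §17 (SETTING, census (C1)–(C3), species (3a)–(3d), LEMMA A∪2I′
v1.1, CLEAN SUFFICIENT FORM, INSTANCES), §15 (LEMMA 2I), §13 (D_ML8 under leak9), §1′ (PAIR-IMAGE THEOREM); s4-ref-2 g8 verdicts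
743ff03f31655d32 ∕ e036450b1c974e99; s4-search-1 g20 `kitds/D_ML8.json` 1b196cbe56773418, `result-j269985-DML8-leak9.json`;
`Pad4TowerLemmaA2I.lean` 974cfe08e56721bd (the (F1ℝ) `Polluter` ∕ `CleanServer` ∕ `A2IDead`, whose shape this file follows);
`Pad4TowerRuleDMu4.lean` (this typer, same filing); `Pad4TowerCrossPhase.lean` 8f09792281b0723a.
-/

namespace Summit.Ventures.HSemireg.Pad4Tower

open Finset

/-! ## §1 Served directions, polluters, clean servers on 𝔅(μ₄) -/

/-- a TIMELIKE difference (either time orientation): `|Δβ|² < Δα²`. `H¹` of a timelike class vanishes (§17 dictionary), so a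
census member's offset `z` is never timelike. -/
abbrev Timelike (Δ : BPoint) : Prop := Δ.2.1 ^ 2 + Δ.2.2 ^ 2 < Δ.1 ^ 2

/-- **`W_f(Z) ∋ w`** (§17 SETTING): the direction `w` on the factor `f` of the `N`-cell `Z` is SERVED BELOW — by a leg
(`MServedBelow`) or by the null `f`-part of an (r2a) cover (`MCoverBelow` with any second factor and direction). -/
abbrev MServedDirBelow (C : MConfig) (Z : MCell) (f w : Fin 4) : Prop :=
  MServedBelow C Z f w ∨ ∃ g b : Fin 4, g ≠ f ∧ MCoverBelow C Z f w g b

/-- **a POLLUTING census member** of the `f″`-server `N′` of the `u`-partner `P` of `Z` on `σ` (§17 (C1)–(C3), species (3b), (3c),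
(3d); (3a) = deeper partners, `z = 0`, are handled by the common confining direction): `P′` agrees with `Z` off `{σ, f″}` ((C1)); `P′_σ`
lies on `Z`'s `u`-ray below `Z_σ` at depth `≥` the depth of `P` ((C2)); and `z := P′_{f″} − Z_{f″}` is non-zero, not timelike, with
`N′_{f″} − P′_{f″}` effective («e·n_v − z future-causal or 0») ((C3)). -/
abbrev PolluterMu4 (Z P N' : MCell) (σ u f'' : Fin 4) (P' : MCell) : Prop :=
  (∀ g, g ≠ σ → g ≠ f'' → P' g = Z g) ∧
    ((P' σ).1 ≤ (P σ).1 ∧ Z σ = ray (P' σ) u ((Z σ).1 - (P' σ).1)) ∧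
    (P' f'' ≠ Z f'' ∧ ¬ Timelike (bsub (P' f'') (Z f'')) ∧ Effective (bsub (N' f'') (P' f'')))

/-- `N′ ∈ E₋` is an UNPOLLUTED (clean) SERVER of the partner `P` in direction `v` on `f″`: `N′ = P + e·n_v^{(f″)}`, `e ≥ 1`, and no
`P′ ∈ E₊` pollutes its row. -/
abbrev CleanServerMu4 (C : MConfig) (Z P N' : MCell) (σ u f'' v : Fin 4) : Prop :=
  UPartner N' P f'' v ∧ ∀ P' ∈ C.upper, ¬ PolluterMu4 Z P N' σ u f'' P'

/-! ## §2 The two clean sufficient forms of LEMMA A∪2I′ over an apex factor with `W = ∅` -/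

/-- **LEMMA A∪2I′ KILL, LINE FORM, on 𝔅(μ₄)** (clean sufficient form; `f″` apex, `W_{f″}(Z) = ∅`): `σ ≠ f″`; `Z_{f″}` is an apex
point; the row `u` of the pair `(σ, f″)` is DEMANDED (`Z_σ` adapted to `u`'s frame and `c_u(x_σ) ≠ α(x_{f″})∕2` — PAIR-IMAGE entry
non-zero); NO direction of `f″` is served below at `Z`; `Z` has NO partner on `σ` outside the frame `{u, −u}`; and EVERY present
`u`-partner of `Z` on `σ` (every depth) has a clean `f″`-server in the ONE direction `v`. Pencil meaning (NOT in Lean): `Z` violates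
(E1) for every choice of sections with non-zero leg entries [§17 LEMMA A∪2I′ + CLEAN SUFFICIENT FORM, ×2 s4-ref-2 g8; the reading
in the module docstring]. With no present `u`-partner the last clause is vacuous (then the demanded row is simply unfed). -/
abbrev A2IDeadMu4Line (C : MConfig) (Z : MCell) (σ u f'' v : Fin 4) : Prop :=
  σ ≠ f'' ∧ isApex (Z f'') ∧ Adapted (Z σ) u ∧ coord (Z σ) u ≠ (Z f'').1 ∧
    (∀ w, ¬ MServedDirBelow C Z f'' w) ∧
    (∀ w, w ≠ u → w ≠ u + 2 → ∀ P ∈ C.upper, ¬ UPartner Z P σ w) ∧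
    ∀ P ∈ C.upper, UPartner Z P σ u → ∃ N' ∈ C.lower, CleanServerMu4 C Z P N' σ u f'' v

/-- **LEMMA A∪2I′ KILL, ZERO FORM, on 𝔅(μ₄)** (= LEMMA 2I of §15 in clean form; `f″` apex, `W_{f″}(Z) = ∅`): `σ ≠ f″`; `Z_{f″}` apex;
SOME row of `(σ, f″)` demanded; no direction of `f″` served below at `Z`; and EVERY present partner of `Z` on `σ`, in EVERY direction
and at every depth, has clean `f″`-servers in TWO DISTINCT directions (state `0`). Pencil meaning (NOT in Lean): `Z` violates (E1). -/
abbrev A2IDeadMu4Zero (C : MConfig) (Z : MCell) (σ f'' : Fin 4) : Prop :=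
  σ ≠ f'' ∧ isApex (Z f'') ∧ (∃ u : Fin 4, Adapted (Z σ) u ∧ coord (Z σ) u ≠ (Z f'').1) ∧
    (∀ w, ¬ MServedDirBelow C Z f'' w) ∧
    ∀ w, ∀ P ∈ C.upper, UPartner Z P σ w →
      ∃ v₁ v₂ : Fin 4, v₁ ≠ v₂ ∧ (∃ N₁ ∈ C.lower, CleanServerMu4 C Z P N₁ σ w f'' v₁) ∧
        ∃ N₂ ∈ C.lower, CleanServerMu4 C Z P N₂ σ w f'' v₂

/-! ## §3 Kernel probes: the D_ML8 pattern of §13∕§15 (the predicates compute; the full-support census is the offline line above) -/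

section Probes

/-- `Z = [O|ℓ₁|ℓ_i|2I]`: an `[O|ℓ|ℓ|2I]`-class of D_ML8 (`σ = 1` carries `ℓ₁`, direction `u = 0`; `f″ = 0` is the `O`-factor). -/
def nDML8 : MCell := mcellOf ptO (lpt 1 0) (lpt 1 1) (2, 0, 0)

/-- the `ℓ₁`-cancellation `P = [O|O|ℓ_i|2I]` (the unique `0`-partner of `nDML8` on `σ = 1`). -/
def pDML8 : MCell := mcellOf ptO ptO (lpt 1 1) (2, 0, 0)

/-- the `O`-server of `pDML8` in direction `v`: `[ℓ_{i^v}|O|ℓ_i|2I]` (an `[O|ℓ|ℓ|2I]`-class of D_ML8 again). Placed in `E₊`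
instead, the same class is the null-lifted sibling of species (3b) of that server (absent from D_ML8's `E₊` = «[O|O|ℓ|2I] ∪
[O|ℓ|ℓ|ℓ]»). -/
def srvDML8 (v : Fin 4) : MCell := mcellOf (lpt 1 v) ptO (lpt 1 1) (2, 0, 0)

/-- the D_ML8 pattern: `Z`, its four `O`-servers' worth of `N`-cells, and its cancellation. -/
def dml8Pattern : MConfig := ⟨{nDML8, srvDML8 0, srvDML8 1, srvDML8 2, srvDML8 3}, {pDML8}⟩

/-- the same with the lifted sibling of the `v = 0` server added to `E₊`. -/
def dml8Polluted : MConfig := ⟨{nDML8, srvDML8 0, srvDML8 1, srvDML8 2, srvDML8 3}, {pDML8, srvDML8 0}⟩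

/-- … and with the lifted siblings of the `v = 0, 1, 2` servers added. -/
def dml8Polluted3 : MConfig :=
  ⟨{nDML8, srvDML8 0, srvDML8 1, srvDML8 2, srvDML8 3}, {pDML8, srvDML8 0, srvDML8 1, srvDML8 2}⟩

set_option synthInstance.maxSize 8192 in
set_option synthInstance.maxHeartbeats 2000000 in -- the unfolded predicates are large decidable instances
/-- **the 2I-carrier dies** (§13∕§15): in the D_ML8 pattern `Z = [O|ℓ₁|ℓ_i|2I]` is LINE-dead at (σ, u, f″) = (1, 0, 0) through the
direction `v = 0` (and ZERO-dead: its cancellation has clean `O`-servers in all four directions). [kernel, `decide`] -/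
theorem dml8Pattern_dead : A2IDeadMu4Line dml8Pattern nDML8 1 0 0 0 ∧ A2IDeadMu4Zero dml8Pattern nDML8 1 0 := by
  constructor <;> decide +kernel

set_option synthInstance.maxSize 8192 in
set_option synthInstance.maxHeartbeats 2000000 in -- as above
/-- **pollution is read correctly**: with the (3b) sibling `[ℓ₁|O|ℓ_i|2I] ∈ E₊` the `v = 0` server is polluted — the LINE form fails
through `v = 0` and still holds through `v = 1`; the ZERO form survives one lifted sibling (directions `1, 2, 3` remain clean) and FAILS
once three servers are polluted (only `v = 3` clean). [kernel, `decide`] -/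
theorem dml8Polluted_reads :
    ¬ A2IDeadMu4Line dml8Polluted nDML8 1 0 0 0 ∧ A2IDeadMu4Line dml8Polluted nDML8 1 0 0 1 ∧
    A2IDeadMu4Zero dml8Polluted nDML8 1 0 ∧ ¬ A2IDeadMu4Zero dml8Polluted3 nDML8 1 0 := by
  refine ⟨?_, ?_, ?_, ?_⟩ <;> decide +kernel

end Probes

end Summit.Ventures.HSemireg.Pad4Tower
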